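import Literature.MathematicalPhysics.QuantumFieldTheory.LatticeGauge
import HarnessLib

/-!
# Exponential decay of correlations under arbitrary boundary conditions (Chatterjee 2021)

Chatterjee, *A probabilistic mechanism for quark confinement*, CMP **385** (2021) 1007–1039
(arXiv:2006.16229) [Chatterjee2021], §2.4, **Definition 2.3**: the Wilson lattice gauge theory
on `ℤ^d` with gauge group `G` at inverse coupling `β` "satisfies exponential decay of correlations
under arbitrary boundary conditions if there are positive constants `K₁` and `K₂` depending only
on `G`, `β` and `d`, such that for any cube `B`, for any boundary condition `δ` on `B`, and for any
local functions `f` and `g` supported on edges in `B` and taking values in `[-1,1]`, we have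
`|⟨fg⟩_{B,δ} - ⟨f⟩_{B,δ}⟨g⟩_{B,δ}| ≤ K₁ e^{-K₂ dist(f,g)}`." Here (loc. cit.) a *cube* is a
translate `v + {0,…,M}^d`, a *boundary condition* assigns group elements to the boundary edges of
the cube, `⟨·⟩_{B,δ}` is the finite-volume Wilson measure on the configurations of the cube
agreeing with `δ` on the boundary, two edges are *neighbours* if they lie in a common plaquette,
a local function *supported on the edge `e`* depends only on the variables on the neighbours of
`e`, and `dist(f,g)` is the distance between the supporting edges. This is the hypothesis of
Chatterjee's Thm. 2.4 (strong decay ⇒ unbroken centre symmetry ⇒ Wilson's area law) and the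
boundary-uniform form of a lattice mass gap used by "infrared-first" routes to the Yang–Mills
summit (requested by `route-QuantumFields-ThermalRuler`).

## Content

* `StrongExpDecayZd d ρ β K₁ K₂` — the displayed inequality of Def. 2.3 with *explicit*
  constants, in dimension `d`, rendered over the tree's DLR kernels `ymSpecification ρ β Λ η`
  (`LatticeGaugeDLR`): the cube is `v + {0,…,M}^d` (all `M : ℕ`, all base points `v`), the
  boundary condition is an arbitrary configuration `η : LGConfig d G`, the finite volume `Λ` is
  the set of *interior* edges of the cube (edges of the cube not contained in a boundary face —
  exactly the edges Chatterjee integrates out; every plaquette through an interior edge lies in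
  the cube, so `γ_Λ(· | η)` depends on `η` only through the boundary links of the cube, i.e. it is
  Chatterjee's measure on `Ω_{B,δ}` with `δ = η|_{∂B}`, the plaquettes lying inside a boundary
  face contributing a constant that cancels in the normalisation), `e₁, e₂` range over all edges
  of the cube (boundary edges allowed), `f`, `g` are measurable, bounded by `1` in absolute value,
  and cylinder functions supported on the plaquette-neighbourhoods
  `(plaquettesTouching {eᵢ}).biUnion plaquetteEdges` of `e₁`, `e₂` (`IsCylinder`), and the
  distance is `QuantumFieldTheory.setDistEdges {e₁} {e₂}` (sup-distance of base points).
* `HasStrongExpDecayZd d ρ β` — Definition 2.3 itself: there exist `K₁, K₂ > 0` with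
  `StrongExpDecayZd d ρ β K₁ K₂`.
* `StrongExpDecay ρ β K₁ K₂ := StrongExpDecayZd 4 ρ β K₁ K₂` and
  `HasStrongExpDecay ρ β := HasStrongExpDecayZd 4 ρ β` — the four-dimensional case, with the
  signature requested by the Yang–Mills routes; `strongExpDecay_iff` records (by `Iff.rfl`) that
  `StrongExpDecay ρ β K₁ K₂` unfolds to the text those routes inline verbatim.
* API: monotonicity in the constants (`StrongExpDecayZd.mono`, `StrongExpDecay.mono`: `K₁` may be
  increased and `K₂` decreased), `StrongExpDecayZd.nonneg` (the property forces `0 ≤ K₁`), the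
  trivial bound `abs_integral_mul_sub_mul_integral_le_two` (`|E[fg] - E[f]E[g]| ≤ 2` for
  `|f|, |g| ≤ 1` under any zero-or-probability measure) and its consequence
  `strongExpDecayZd_of_two_le` (`K₁ ≥ 2`, `K₂ ≤ 0` always work — so the content of Def. 2.3 is
  the positivity of `K₂`), and `HasStrongExpDecayZd.of_pos` (only `K₂ > 0` needs checking).

## Faithfulness flags

* Distance: Chatterjee's `dist(f,g)` is the Euclidean distance between the midpoints of the
  supporting edges; here it is the `ℓ^∞` distance between their base points
  (`QuantumFieldTheory.setDistEdges`, the tree's convention, shared with the Shen–Zhu–Zhu mass-gap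
  statements). Writing `D∞` for the latter and `D₂` for Chatterjee's distance,
  `D∞ - 1/2 ≤ ‖m₁ - m₂‖_∞ ≤ D₂ ≤ √d (D∞ + 1/2)` (a midpoint is offset by `½eᵢ` from its base
  point), so the classes of theories satisfying `HasStrongExpDecayZd` agree, with the constants
  changing as `(K₁, K₂) ↦ (K₁ e^{K₂/2}, K₂)` (Chatterjee's ⇒ this file's) resp.
  `(K₁, K₂) ↦ (K₁ e^{K₂/2}, K₂ / √d)` (this file's ⇒ Chatterjee's).
* Local functions are functions on the whole configuration space `LGConfig d G` that are
  cylinder on the plaquette-neighbourhood of an edge of the cube; for a boundary edge that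
  neighbourhood pokes out of the cube, where the configuration is frozen to `η` under
  `γ_Λ(· | η)`, so for each fixed `η` these are exactly Chatterjee's local functions on `Ω_{B,δ}`
  (and conversely every such function extends by ignoring the outside links).
* Gauge group: Chatterjee takes `G` a closed connected subgroup of `U(n)` acting by the defining
  representation; the tree's `ymSpecification` allows any compact group with a matrix
  representation `ρ` (Wilson action `∑ₚ (n - Re tr ρ(U_p))`, the constant `n` cancelling in the
  normalisation), which is the same measure in Chatterjee's setting.
* Degenerate cubes: `M = 0` has no edges (vacuous) and `M = 1` has no interior edges (`Λ = ∅`,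
  the kernel is the Dirac mass at `η`, all covariances vanish); Chatterjee's cubes have `M ≥ 1`.
  Neither affects the notion.

## References

* S. Chatterjee, *A probabilistic mechanism for quark confinement*, Comm. Math. Phys. 385 (2021)
  1007–1039, doi:10.1007/s00220-021-04086-y, arXiv:2006.16229 — §2.1 (lattice gauge theories),
  §2.4 (neighbouring edges, local functions, cubes, boundary conditions, Definition 2.3,
  Theorem 2.4).
-/

noncomputable section

open _root_.MeasureTheory
open Literature.MathematicalPhysics.QuantumFieldTheory (setDistEdges setDistEdges_nonneg)

namespace Literature.MathematicalPhysics.QuantumLattice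

/-! ### A covariance bound under zero-or-probability measures -/

section Covariance

variable {X : Type*} [MeasurableSpace X] {μ : Measure X}

/-- Under a zero-or-probability measure, a function bounded by `1` in absolute value has integral
of absolute value at most `1` (the Bochner integral of a non-integrable function being `0`). [folklore] -/
theorem abs_integral_le_one_of_abs_le_one [IsZeroOrProbabilityMeasure μ] {f : X → ℝ}
    (hf : ∀ x, |f x| ≤ 1) : |∫ x, f x ∂μ| ≤ 1 := by
  have h : ‖∫ x, f x ∂μ‖ ≤ 1 * μ.real Set.univ :=
    norm_integral_le_of_norm_le_const (Filter.Eventually.of_forall fun x => by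
      rw [Real.norm_eq_abs]; exact hf x)
  rw [Real.norm_eq_abs, one_mul] at h
  exact h.trans measureReal_le_one

/-- The trivial covariance bound: under a zero-or-probability measure, for `f`, `g` bounded by `1`
in absolute value, `|E[fg] - E[f] E[g]| ≤ 2` (this is the remark that in Chatterjee's
Definition 2.3 only the rate `K₂ > 0` carries content: `K₁ = 2`, `K₂ = 0` always work). [folklore] -/
theorem abs_integral_mul_sub_mul_integral_le_two [IsZeroOrProbabilityMeasure μ] {f g : X → ℝ}
    (hf : ∀ x, |f x| ≤ 1) (hg : ∀ x, |g x| ≤ 1) :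
    |(∫ x, f x * g x ∂μ) - (∫ x, f x ∂μ) * (∫ x, g x ∂μ)| ≤ 2 := by
  have hfg : ∀ x, |f x * g x| ≤ 1 := fun x => by
    rw [abs_mul]
    exact mul_le_one₀ (hf x) (abs_nonneg _) (hg x)
  calc |(∫ x, f x * g x ∂μ) - (∫ x, f x ∂μ) * (∫ x, g x ∂μ)|
      ≤ |∫ x, f x * g x ∂μ| + |(∫ x, f x ∂μ) * (∫ x, g x ∂μ)| := abs_sub _ _
    _ = |∫ x, f x * g x ∂μ| + |∫ x, f x ∂μ| * |∫ x, g x ∂μ| := by rw [abs_mul]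
    _ ≤ 1 + 1 * 1 :=
        add_le_add (abs_integral_le_one_of_abs_le_one hfg)
          (mul_le_mul (abs_integral_le_one_of_abs_le_one hf)
            (abs_integral_le_one_of_abs_le_one hg) (abs_nonneg _) zero_le_one)
    _ = 2 := by norm_num

end Covariance

/-! ### Chatterjee's Definition 2.3 -/

section Definition

variable {n : ℕ} {G : Type*} [Group G] [TopologicalSpace G] [IsTopologicalGroup G]
  [CompactSpace G] [MeasurableSpace G] [BorelSpace G]

/-- **Exponential decay of correlations under arbitrary boundary conditions, with constants
`K₁, K₂`, in dimension `d`** (Chatterjee 2021, Def. 2.3, the displayed inequality): for every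
cube `v + {0,…,M}^d ⊆ ℤ^d`, every boundary condition `η`, all edges `e₁, e₂` of the cube and all
measurable `f, g : LGConfig d G → ℝ` with `|f|, |g| ≤ 1` depending only on the links sharing a
plaquette with `e₁` resp. `e₂`,
`|E[fg] - E[f] E[g]| ≤ K₁ exp (-K₂ dist(e₁, e₂))` under the Wilson DLR kernel
`γ_Λ(· | η) = ymSpecification ρ β Λ η` of the set `Λ` of interior edges of the cube (the edges
`(x, i)` of the cube with `v j < x j < v j + M` for all `j ≠ i`, i.e. those not lying in a
boundary face), `dist` being the sup-distance of base points (`QuantumFieldTheory.setDistEdges`;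
Chatterjee: Euclidean distance of midpoints — equivalent up to the constants, see the module
docstring). The hypothesis `Λ = …` is a `let`. [cite: Chatterjee2021, Def. 2.3] -/
def StrongExpDecayZd (d : ℕ) (ρ : G →* Matrix (Fin n) (Fin n) ℂ) (β K₁ K₂ : ℝ) : Prop :=
  ∀ (M : ℕ) (v : Fin d → ℤ) (Λ : Finset (ZdEdge d)) (η : LGConfig d G) (e₁ e₂ : ZdEdge d)
    (f g : LGConfig d G → ℝ),
    Λ = (((Fintype.piFinset fun j : Fin d => Finset.Icc (v j) (v j + M)) ×ˢ
        (Finset.univ : Finset (Fin d))).filter fun e =>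
          e.1 e.2 + 1 ≤ v e.2 + M ∧ ∀ j, j ≠ e.2 → v j < e.1 j ∧ e.1 j < v j + M) →
    (∀ j, v j ≤ e₁.1 j ∧ e₁.1 j ≤ v j + M) → e₁.1 e₁.2 + 1 ≤ v e₁.2 + M →
    (∀ j, v j ≤ e₂.1 j ∧ e₂.1 j ≤ v j + M) → e₂.1 e₂.2 + 1 ≤ v e₂.2 + M →
    Measurable f → Measurable g →
    IsCylinder f ((plaquettesTouching {e₁}).biUnion plaquetteEdges) →
    IsCylinder g ((plaquettesTouching {e₂}).biUnion plaquetteEdges) →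
    (∀ U, |f U| ≤ 1) → (∀ U, |g U| ≤ 1) →
    |(∫ U, f U * g U ∂(ymSpecification (d := d) ρ β Λ η)) -
        (∫ U, f U ∂(ymSpecification (d := d) ρ β Λ η)) *
          (∫ U, g U ∂(ymSpecification (d := d) ρ β Λ η))| ≤
      K₁ * Real.exp (-(K₂ * QuantumFieldTheory.setDistEdges {e₁} {e₂}))

/-- **Chatterjee's Definition 2.3** (exponential decay of correlations under arbitrary boundary
conditions) for the Wilson lattice gauge theory `(G, ρ, β)` on `ℤ^d`: there are positive
constants `K₁, K₂` (depending only on the theory) such that `StrongExpDecayZd d ρ β K₁ K₂`.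
This is the hypothesis of Chatterjee's Thm. 2.4 (⇒ unbroken centre symmetry ⇒ area law). [cite: Chatterjee2021, Def. 2.3] -/
def HasStrongExpDecayZd (d : ℕ) (ρ : G →* Matrix (Fin n) (Fin n) ℂ) (β : ℝ) : Prop :=
  ∃ K₁ K₂ : ℝ, 0 < K₁ ∧ 0 < K₂ ∧ StrongExpDecayZd d ρ β K₁ K₂

/-- **Exponential decay of correlations under arbitrary boundary conditions with constants
`K₁, K₂` for four-dimensional Wilson lattice gauge theory** (Chatterjee 2021, Def. 2.3 with
`d = 4`): `StrongExpDecayZd 4 ρ β K₁ K₂`; see `strongExpDecay_iff` for the unfolded form. [cite: Chatterjee2021, Def. 2.3] -/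
def StrongExpDecay (ρ : G →* Matrix (Fin n) (Fin n) ℂ) (β K₁ K₂ : ℝ) : Prop :=
  StrongExpDecayZd 4 ρ β K₁ K₂

/-- **Chatterjee's Definition 2.3 in four dimensions**: there are `K₁, K₂ > 0` with
`StrongExpDecay ρ β K₁ K₂`. [cite: Chatterjee2021, Def. 2.3] -/
def HasStrongExpDecay (ρ : G →* Matrix (Fin n) (Fin n) ℂ) (β : ℝ) : Prop :=
  HasStrongExpDecayZd 4 ρ β

variable {ρ : G →* Matrix (Fin n) (Fin n) ℂ} {β K₁ K₂ K₁' K₂' : ℝ} {d : ℕ}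

/-- `StrongExpDecay ρ β K₁ K₂` unfolded: the four-dimensional statement verbatim (this is the
text the Yang–Mills routes inline). [cite: Chatterjee2021, Def. 2.3] -/
theorem strongExpDecay_iff :
    StrongExpDecay ρ β K₁ K₂ ↔
      ∀ (M : ℕ) (v : Fin 4 → ℤ) (Λ : Finset (ZdEdge 4)) (η : LGConfig 4 G) (e₁ e₂ : ZdEdge 4)
        (f g : LGConfig 4 G → ℝ),
        Λ = (((Fintype.piFinset fun j : Fin 4 => Finset.Icc (v j) (v j + M)) ×ˢ
            (Finset.univ : Finset (Fin 4))).filter fun e =>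
              e.1 e.2 + 1 ≤ v e.2 + M ∧ ∀ j, j ≠ e.2 → v j < e.1 j ∧ e.1 j < v j + M) →
        (∀ j, v j ≤ e₁.1 j ∧ e₁.1 j ≤ v j + M) → e₁.1 e₁.2 + 1 ≤ v e₁.2 + M →
        (∀ j, v j ≤ e₂.1 j ∧ e₂.1 j ≤ v j + M) → e₂.1 e₂.2 + 1 ≤ v e₂.2 + M →
        Measurable f → Measurable g →
        IsCylinder f ((plaquettesTouching {e₁}).biUnion plaquetteEdges) →
        IsCylinder g ((plaquettesTouching {e₂}).biUnion plaquetteEdges) →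
        (∀ U, |f U| ≤ 1) → (∀ U, |g U| ≤ 1) →
        |(∫ U, f U * g U ∂(ymSpecification (d := 4) ρ β Λ η)) -
            (∫ U, f U ∂(ymSpecification (d := 4) ρ β Λ η)) *
              (∫ U, g U ∂(ymSpecification (d := 4) ρ β Λ η))| ≤
          K₁ * Real.exp (-(K₂ * QuantumFieldTheory.setDistEdges {e₁} {e₂})) :=
  Iff.rfl

/-- `HasStrongExpDecay` unfolded. [cite: Chatterjee2021, Def. 2.3] -/
theorem hasStrongExpDecay_iff :
    HasStrongExpDecay ρ β ↔ ∃ K₁ K₂ : ℝ, 0 < K₁ ∧ 0 < K₂ ∧ StrongExpDecay ρ β K₁ K₂ :=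
  Iff.rfl

/-- The Wilson DLR kernel `ymSpecification ρ β Λ η` is a zero-or-probability measure (a tilted
probability measure; Mathlib `isZeroOrProbabilityMeasure_tilted`). [folklore] -/
instance isZeroOrProbabilityMeasure_ymSpecification (Λ : Finset (ZdEdge d)) (η : LGConfig d G) :
    IsZeroOrProbabilityMeasure (ymSpecification (d := d) ρ β Λ η) := by
  unfold ymSpecification
  infer_instance

/-- Monotonicity of Chatterjee's decay property in the constants: `K₁` may be increased and the
rate `K₂` decreased. [folklore] -/
theorem StrongExpDecayZd.mono (h : StrongExpDecayZd d ρ β K₁ K₂) (h₁ : K₁ ≤ K₁') (h₂ : K₂' ≤ K₂) :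
    StrongExpDecayZd d ρ β K₁' K₂' := by
  intro M v Λ η e₁ e₂ f g hΛ he₁ he₁' he₂ he₂' hf hg hfc hgc hfb hgb
  have h0 := h M v Λ η e₁ e₂ f g hΛ he₁ he₁' he₂ he₂' hf hg hfc hgc hfb hgb
  have hK₁ : 0 ≤ K₁ :=
    (mul_nonneg_iff_of_pos_right (Real.exp_pos _)).1 ((abs_nonneg _).trans h0)
  have hD : 0 ≤ setDistEdges {e₁} {e₂} := setDistEdges_nonneg {e₁} {e₂}
  refine h0.trans ?_
  calc K₁ * Real.exp (-(K₂ * setDistEdges {e₁} {e₂}))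
      ≤ K₁' * Real.exp (-(K₂ * setDistEdges {e₁} {e₂})) :=
        mul_le_mul_of_nonneg_right h₁ (Real.exp_nonneg _)
    _ ≤ K₁' * Real.exp (-(K₂' * setDistEdges {e₁} {e₂})) :=
        mul_le_mul_of_nonneg_left
          (Real.exp_le_exp.2 (neg_le_neg (mul_le_mul_of_nonneg_right h₂ hD))) (hK₁.trans h₁)

/-- Monotonicity of the four-dimensional decay property in the constants. [folklore] -/
theorem StrongExpDecay.mono (h : StrongExpDecay ρ β K₁ K₂) (h₁ : K₁ ≤ K₁') (h₂ : K₂' ≤ K₂) :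
    StrongExpDecay ρ β K₁' K₂' :=
  StrongExpDecayZd.mono h h₁ h₂

/-- The decay property forces `0 ≤ K₁` (test it on the cube `{0,1}^d`, `e₁ = e₂`, `f = g = 0`).
[folklore] -/
theorem StrongExpDecayZd.nonneg [NeZero d] (h : StrongExpDecayZd d ρ β K₁ K₂) : 0 ≤ K₁ := by
  have h0 := h 1 0 _ (fun _ => 1) 0 0 (fun _ => 0) (fun _ => 0) rfl (fun j => by simp) (by simp)
    (fun j => by simp) (by simp) measurable_const measurable_const (fun _ _ _ => rfl)
    (fun _ _ _ => rfl) (fun _ => by simp) (fun _ => by simp)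
  exact (mul_nonneg_iff_of_pos_right (Real.exp_pos _)).1 ((abs_nonneg _).trans h0)

/-- The four-dimensional decay property forces `0 ≤ K₁`. [folklore] -/
theorem StrongExpDecay.nonneg (h : StrongExpDecay ρ β K₁ K₂) : 0 ≤ K₁ :=
  StrongExpDecayZd.nonneg h

/-- The trivial case of Chatterjee's inequality: with `K₁ ≥ 2` and a non-positive rate `K₂ ≤ 0`
it holds for every theory, since `|E[fg] - E[f]E[g]| ≤ 2` for `|f|, |g| ≤ 1` (the content of
Def. 2.3 is `K₂ > 0`). [folklore] -/
theorem strongExpDecayZd_of_two_le (ρ : G →* Matrix (Fin n) (Fin n) ℂ) (β : ℝ) (h₁ : 2 ≤ K₁)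
    (h₂ : K₂ ≤ 0) : StrongExpDecayZd d ρ β K₁ K₂ := by
  intro M v Λ η e₁ e₂ f g _ _ _ _ _ _ _ _ _ hfb hgb
  have hD : 0 ≤ setDistEdges {e₁} {e₂} := setDistEdges_nonneg {e₁} {e₂}
  refine (abs_integral_mul_sub_mul_integral_le_two hfb hgb).trans ?_
  calc (2 : ℝ) ≤ K₁ * 1 := by linarith
    _ ≤ K₁ * Real.exp (-(K₂ * setDistEdges {e₁} {e₂})) :=
        mul_le_mul_of_nonneg_left
          (Real.one_le_exp (neg_nonneg.2 (mul_nonpos_of_nonpos_of_nonneg h₂ hD))) (by linarith)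

/-- The trivial case in four dimensions: `StrongExpDecay ρ β K₁ K₂` for `K₁ ≥ 2`, `K₂ ≤ 0`. [folklore] -/
theorem strongExpDecay_of_two_le (ρ : G →* Matrix (Fin n) (Fin n) ℂ) (β : ℝ) (h₁ : 2 ≤ K₁)
    (h₂ : K₂ ≤ 0) : StrongExpDecay ρ β K₁ K₂ :=
  strongExpDecayZd_of_two_le ρ β h₁ h₂

/-- To establish Chatterjee's Definition 2.3 it suffices to have the inequality with *some* `K₁`
and a positive rate `K₂` (`K₁` can be raised to `max K₁ 1 > 0`). [folklore] -/
theorem HasStrongExpDecayZd.of_pos (h : StrongExpDecayZd d ρ β K₁ K₂) (hK₂ : 0 < K₂) :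
    HasStrongExpDecayZd d ρ β :=
  ⟨max K₁ 1, K₂, lt_max_of_lt_right one_pos, hK₂, h.mono (le_max_left _ _) le_rfl⟩

/-- Four-dimensional version of `HasStrongExpDecayZd.of_pos`. [folklore] -/
theorem HasStrongExpDecay.of_pos (h : StrongExpDecay ρ β K₁ K₂) (hK₂ : 0 < K₂) :
    HasStrongExpDecay ρ β :=
  HasStrongExpDecayZd.of_pos h hK₂

/-- Chatterjee's Definition 2.3 holds iff the inequality holds with some positive rate `K₂` and
some (automatically non-negative, and then improvable to positive) constant `K₁`. [folklore] -/
theorem hasStrongExpDecayZd_iff_exists_rate_pos :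
    HasStrongExpDecayZd d ρ β ↔ ∃ K₂ : ℝ, 0 < K₂ ∧ ∃ K₁ : ℝ, StrongExpDecayZd d ρ β K₁ K₂ :=
  ⟨fun ⟨K₁, K₂, _, hK₂, h⟩ => ⟨K₂, hK₂, K₁, h⟩, fun ⟨_, hK₂, _, h⟩ => .of_pos h hK₂⟩

end Definition

end Literature.MathematicalPhysics.QuantumLattice
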